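import Summits.AtomisticToContinuum.Crystallization.Theorems.FrustratedLawDichotomyStrainedPatchHomEntryLeafHTCross090B
import Summits.AtomisticToContinuum.Crystallization.Theorems.FrustratedLawDichotomyStrainedPatchHomEntryFitHcpMinPairsLeaf

/-!
# ★★★ CROSSOVER CELL at `0.9 t_b` (`U 2⁻¹²`), part C: the inner sub-tree closes the confined box with FOUR leaves of the min-pairs verdict — the slab leaf FIRES
# (27623 `(H) HomFloor (1/625)`, hcp half; critic rows 1172 / 1175 «fresh-cert crossover cell @2⁻¹²» and (β) «leaf wall»; hand-1 g31)

decomp-a2c hand-1 g31 (crux `AperiodicFrustratedLawGap`, stmt-AtomisticToContinuum-27623).  Cell `cX90 × wX` and certificate `pX90` of `…Cross090A/B`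
(confined box `htWr pX90 cX90 wX ≈ (1.96, 2.48, 0.92)·10⁻³`).  KERNEL (seat `work/ktree`, hand-1 g31): with the inner verdict of record
`…HomEntryFitHcpCentred.entryLeafOKHQD muRec` (all-pairs fit) NO uniform sub-tree up to 64 leaves closes this box (`treeOK … = false` after 379 s / 404 s for
32 / 64 leaves: the out-of-slab corners of the box carry all-pairs misfit above threshold); with the MIN-PAIRS verdict `…MinPairsLeaf.entryLeafOKHQDM muRec`
the 4-leaf tree `tX4` (split `ξ₁`, then `ξ₀`) closes it in 66 s:

* `treeOKDM_X90` — KERNEL (66 s): `treeOK (entryLeafOKHQDM muRec) tX4 cX90 (htWr pX90 cX90 wX) = true`;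
* `treeOK5DM_X90` — KERNEL: the same with the in-tree slab-out prune in front (the verdict lambda of `…HomSlabPrune.entryLeafOKHT5`);
* ★★★ `entryLeafOKHT5QDM_X90` — `entryLeafOKHT5QDM muRec pX90 tX4 cX90 wX = true`: THE PRUNED ANALYTIC-SLAB LEAF WITH THE MIN-PAIRS INNER VERDICT CLOSES THE
  `0.9 t_b` CROSSOVER CELL AT ENTRY HALF-WIDTH `2⁻¹²` END TO END (assembled by rewriting from `…Cross090B.htCertSide_X90`; by `entryLeafOKHT5QDM_sound` the hver
  conclusion holds on the whole cell).  (β) wall of this production-shaped leaf: certificate side ≈ 630 s (8 facts) + inner tree 66 s.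

Kernel definition (`tX4`) + kernel facts + assembly; 0 sorry; standard axioms.  `--supports stmt-AtomisticToContinuum-27623`.
-/

namespace Summit.AtomisticToContinuum.Crystallization.Theorems.FrustratedLawDichotomyStrainedPatchHomEntryLeafHT

open Literature.Analysis.ValidatedNumerics.Numerics
open Summit.AtomisticToContinuum.Crystallization.Theorems.FrustratedLawDichotomyStrainedPatchHomCertTree (CertTree treeOK)
open Summit.AtomisticToContinuum.Crystallization.Theorems.FrustratedLawDichotomyStrainedPatchHomEntryTable (muRec)
open Summit.AtomisticToContinuum.Crystallization.Theorems.FrustratedLawDichotomyStrainedPatchHomEntryFitHcpCentred (entryLeafOKHQDM)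

/-- Inner sub-tree over the confined box of the `0.9 t_b` crossover cell: split `ξ₁`, then `ξ₀` (4 leaves of `(0.98, 1.24, 0.92)·10⁻³`). -/
def tX4 : CertTree ((Fin 3 × Fin 3) ⊕ Fin 3) := .split (Sum.inr 1) (.split (Sum.inr 0) .leaf .leaf) (.split (Sum.inr 0) .leaf .leaf)

set_option maxRecDepth 100000 in
set_option maxHeartbeats 4000000 in
/-- ★★ KERNEL (66 s): the min-pairs quick verdict closes the confined box of the `0.9 t_b` cell with four sub-boxes. -/
theorem treeOKDM_X90 : treeOK (entryLeafOKHQDM muRec) tX4 cX90 (htWr pX90 cX90 wX) = true := by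
  decide +kernel

set_option maxRecDepth 100000 in
set_option maxHeartbeats 4000000 in
/-- ★★ KERNEL: the same through the pruned verdict of `…HomSlabPrune.entryLeafOKHT5` (slab-out test first, then the min-pairs quick verdict). -/
theorem treeOK5DM_X90 :
    treeOK (fun c' w' => slabOut pX90 cX90 wX c' w' || entryLeafOKHQDM muRec c' w') tX4 cX90 (htWr pX90 cX90 wX) = true := by
  decide +kernel

/-- ★★★ **THE PRUNED SLAB LEAF WITH THE MIN-PAIRS INNER VERDICT FIRES ON THE `0.9 t_b` CROSSOVER CELL AT `U 2⁻¹²`.** [assembly by rewriting] -/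
theorem entryLeafOKHT5QDM_X90 : entryLeafOKHT5QDM muRec pX90 tX4 cX90 wX = true := by
  have h1 := htCertSide_X90
  have h2 := treeOK5DM_X90
  unfold entryLeafOKHT5QDM entryLeafOKHT5
  rw [h1, h2]
  rfl

end Summit.AtomisticToContinuum.Crystallization.Theorems.FrustratedLawDichotomyStrainedPatchHomEntryLeafHT
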